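import Summits.AnomalousDissipation.AnomalousDissipation.Theorems.SoloInformedLongTimeOnsager
import HarnessLib

/-!
# Every witness of the zeroth law is Onsager-singular in long-time cubic mean (solo-informed, part 2)

Consequences of the long-time Onsager bound `lerayHopf_meanDissipation_le_rpow'`
(`SoloInformedLongTimeOnsager`) for the summit `AnomalousDissipation` (= `Literature.Turb.ZerothLaw`):

* `uniformlyBesov_family_meanDissipation_tendsto_zero` — along ANY vanishing-viscosity family of
  global Leray–Hopf solutions driven by one steady smooth divergence-free force on `T^d` whose cubed
  `L³(0,T;B^σ_{3,∞})` norms (`1/3 < σ ≤ 1`) grow at most linearly in `T` with a common slope `A`,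
  the long-time mean dissipation `⟨ν_j‖∇u_j‖₂²⟩` tends to zero (Drivas–Eyink 2019, Thm. 1,
  transported to `limsup_{T→∞}` time averages);
* `zerothLaw_witness_not_uniformly_besov`, `zerothLaw_witness_eventually_rough`,
  `anomalousDissipation_imp_onsagerSingularWitness` — hence every witness `(f, ν_j, u_j, ε)` of the
  zeroth law is Onsager-singular in long-time cubic mean: for every `σ ∈ (1/3,1]` and every slope
  `A`, for all large `j` and every `B` there is a window `[0,T]` on which
  `u_j ∉ L³(0,T;B^σ_{3,∞})` or `‖u_j‖³_{L³(0,T;B^σ_{3,∞})} > AT + B`; i.e. the long-time mean of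
  `‖u_j(t)‖³_{B^σ_{3,∞}}` exceeds every slope as `ν_j → 0` (quantitatively it must grow at least
  like `ε ν_j^{-(3σ-1)/(σ+1)}`, by `lerayHopf_meanDissipation_le_rpow'`).  Together with
  `SoloInformedWitnessConstraints` (`⟨‖∇u_j‖₂²⟩ ≥ ε/ν_j`, persistent injection `⟨f·u_j⟩ ≥ ε`)
  this is the kernel-checked profile of what any solution of the summit must look like.

References: T. D. Drivas, G. L. Eyink, Nonlinearity 32 (2019) 4465–4482, Thm. 1 [DrivasEyink2019].
-/

noncomputable section

open MeasureTheory Filter Topology Set Function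
open scoped ENNReal NNReal InnerProductSpace RealInnerProductSpace

namespace Summit.AnomalousDissipation.AnomalousDissipation.Theorems

open Literature.Analysis Literature.Analysis.FunctionSpaces Literature.Analysis.FluidPDE

variable {d : Type*} [Fintype d] [DecidableEq d]

/-! ### Families with vanishing viscosity -/

/-- **No anomalous dissipation for uniformly Onsager-regular families (long-time form).** Let `f`
be a steady smooth divergence-free force on `T^d`, `ν_j → 0⁺`, and `u_j` global Leray–Hopf
solutions with viscosity `ν_j` and force `f` (any data).  If for some `σ ∈ (1/3, 1]` and a common
slope `A` every `u_j` satisfies `u_j ∈ L³(0,T;B^σ_{3,∞})` and `‖u_j‖³_{L³(0,T;B^σ_{3,∞})} ≤ AT + B_j`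
for all `T > 0`, then the long-time mean dissipation `⟨ν_j‖∇u_j‖₂²⟩` tends to `0`
(Drivas–Eyink 2019, Thm. 1, transported to long-time averages). [cite: DrivasEyink2019, Thm. 1] -/
theorem uniformlyBesov_family_meanDissipation_tendsto_zero {σ : ℝ} (hσ : 1 / 3 < σ ∧ σ ≤ 1)
    {f : UnitAddTorus d → EuclideanSpace ℝ d} (hf : Torus.IsSmooth f) (hdiv : Torus.IsDivFree f)
    {ν : ℕ → ℝ} {u₀ : ℕ → UnitAddTorus d → EuclideanSpace ℝ d}
    {u : ℕ → ℝ → UnitAddTorus d → EuclideanSpace ℝ d}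
    (hν : ∀ j, 0 < ν j) (hν₀ : Tendsto ν atTop (𝓝 0))
    (hu : ∀ j, Torus.IsGlobalLerayHopf (ν j) (fun _ => f) (u₀ j) (u j)) {A : ℝ}
    (hreg : ∀ j, ∃ B : ℝ, ∀ T, 0 < T → MemLpBesovSup 3 σ 3 (u j) volume (Ioo 0 T) ∧
      (eLpBesovSupNorm 3 σ 3 (u j) volume (Ioo 0 T)).toReal ^ 3 ≤ A * T + B) :
    Tendsto (fun j => meanDissipation (ν j) (u j)) atTop (𝓝 0) := by
  have hσ1 : 0 < σ + 1 := by linarith [hσ.1]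
  set p : ℝ := (3 * σ - 1) / (σ + 1) with hp
  have hp0 : 0 < p := div_pos (by linarith [hσ.1]) hσ1
  set A' : ℝ := max A 0 with hA'
  have hA'0 : 0 ≤ A' := le_max_right _ _
  set K : ℝ := (Fintype.card d : ℝ) ^ 2 * (2 * FunctionSpaces.Torus.gradProfileMass d) * A' +
    (Fintype.card d : ℝ) ^ 2 * FunctionSpaces.Torus.gradProfileMass d ^ 2 * (1 + A') +
    2 * (Fintype.card d : ℝ) * (eBesovSupNorm σ 2 f volume).toReal * (1 + A') with hK
  -- the quantitative bound for every large `j`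
  have hbound : ∀ j, ν j ≤ (1 / 4 : ℝ) ^ (σ + 1) → meanDissipation (ν j) (u j) ≤ K * ν j ^ p := by
    intro j hj
    obtain ⟨B, hB⟩ := hreg j
    have hreg' : ∀ T, 0 < T → MemLpBesovSup 3 σ 3 (u j) volume (Ioo 0 T) ∧
        (eLpBesovSupNorm 3 σ 3 (u j) volume (Ioo 0 T)).toReal ^ 3 ≤ A' * T + B := by
      intro T hT
      refine ⟨(hB T hT).1, (hB T hT).2.trans ?_⟩
      exact add_le_add (mul_le_mul_of_nonneg_right (le_max_left _ _) hT.le) le_rfl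
    exact lerayHopf_meanDissipation_le_rpow' hσ (hν j) hj hA'0 hf hdiv (hu j) hreg'
  -- squeeze
  have hνp : Tendsto (fun j => K * ν j ^ p) atTop (𝓝 0) := by
    have h1 : Tendsto (fun j => ν j ^ p) atTop (𝓝 0) := by
      have hc := ((Real.continuous_rpow_const hp0.le).tendsto 0).comp hν₀
      simpa [Function.comp_def, Real.zero_rpow hp0.ne'] using hc
    simpa using h1.const_mul K
  have hev : ∀ᶠ j in atTop, ν j ≤ (1 / 4 : ℝ) ^ (σ + 1) :=
    hν₀ (Iic_mem_nhds (by positivity))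
  refine tendsto_of_tendsto_of_tendsto_of_le_of_le' tendsto_const_nhds hνp
    (Eventually.of_forall fun j => meanDissipation_nonneg (hν j).le (u j)) ?_
  filter_upwards [hev] with j hj using hbound j hj

/-! ### Consequences for the zeroth law on `T³` -/

/-- The physical flat unit torus `T³ = (ℝ/ℤ)³` (local notation). -/
local notation "𝕋³" => UnitAddTorus (Fin 3)
/-- Velocity values on `T³` (local notation). -/
local notation "E³" => EuclideanSpace ℝ (Fin 3)

/-- **Every witness of the zeroth law is Onsager-singular in long-time cubic mean.** For a
witness `(f, ν_j, u_j, ε)` of `Literature.Turb.ZerothLaw` (steady smooth divergence-free force,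
`ν_j → 0⁺`, global Leray–Hopf solutions, `⟨ν_j‖∇u_j‖₂²⟩ ≥ ε > 0`), every `σ ∈ (1/3,1]` and
every slope `A`, there is NO choice of constants `B_j` with `u_j ∈ L³(0,T;B^σ_{3,∞})` and
`‖u_j‖³_{L³(0,T;B^σ_{3,∞})} ≤ AT + B_j` for all `j` and `T > 0`. [cite: DrivasEyink2019, Thm. 1] -/
theorem zerothLaw_witness_not_uniformly_besov {f : 𝕋³ → E³} (hf : Torus.IsSmooth f)
    (hdiv : Torus.IsDivFree f) {ν : ℕ → ℝ} {u₀ : ℕ → 𝕋³ → E³} {u : ℕ → ℝ → 𝕋³ → E³}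
    (hν : ∀ j, 0 < ν j) (hν₀ : Tendsto ν atTop (𝓝 0))
    (hu : ∀ j, Torus.IsGlobalLerayHopf (ν j) (fun _ => f) (u₀ j) (u j))
    {ε : ℝ} (hε : 0 < ε) (hεD : ∀ j, ε ≤ meanDissipation (ν j) (u j))
    {σ : ℝ} (hσ : 1 / 3 < σ ∧ σ ≤ 1) (A : ℝ) :
    ¬ ∀ j, ∃ B : ℝ, ∀ T, 0 < T → MemLpBesovSup 3 σ 3 (u j) volume (Ioo 0 T) ∧
      (eLpBesovSupNorm 3 σ 3 (u j) volume (Ioo 0 T)).toReal ^ 3 ≤ A * T + B := by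
  intro hreg
  have h := uniformlyBesov_family_meanDissipation_tendsto_zero hσ hf hdiv hν hν₀ hu hreg
  have hev : ∀ᶠ j in atTop, meanDissipation (ν j) (u j) < ε := h (Iio_mem_nhds hε)
  obtain ⟨j, hj⟩ := hev.exists
  exact absurd (hεD j) (not_le.2 hj)

/-- **Eventual form.** In the situation of `zerothLaw_witness_not_uniformly_besov`, for every
`σ ∈ (1/3,1]` and every slope `A`: for all sufficiently large `j`, for every `B` there is a window
`[0,T]` on which `u_j ∉ L³(0,T;B^σ_{3,∞})` or `‖u_j‖³_{L³(0,T;B^σ_{3,∞})} > AT + B` — the long-time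
mean of `‖u_j(t)‖³_{B^σ_{3,∞}}` exceeds every slope as `ν_j → 0`. [cite: DrivasEyink2019, Thm. 1] -/
theorem zerothLaw_witness_eventually_rough {f : 𝕋³ → E³} (hf : Torus.IsSmooth f)
    (hdiv : Torus.IsDivFree f) {ν : ℕ → ℝ} {u₀ : ℕ → 𝕋³ → E³} {u : ℕ → ℝ → 𝕋³ → E³}
    (hν : ∀ j, 0 < ν j) (hν₀ : Tendsto ν atTop (𝓝 0))
    (hu : ∀ j, Torus.IsGlobalLerayHopf (ν j) (fun _ => f) (u₀ j) (u j))
    {ε : ℝ} (hε : 0 < ε) (hεD : ∀ j, ε ≤ meanDissipation (ν j) (u j))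
    {σ : ℝ} (hσ : 1 / 3 < σ ∧ σ ≤ 1) (A : ℝ) :
    ∀ᶠ j in atTop, ∀ B : ℝ, ∃ T : ℝ, 0 < T ∧
      (MemLpBesovSup 3 σ 3 (u j) volume (Ioo 0 T) →
        A * T + B < (eLpBesovSupNorm 3 σ 3 (u j) volume (Ioo 0 T)).toReal ^ 3) := by
  by_contra hnot
  have hfreq : ∃ᶠ j in atTop, ∃ B : ℝ, ∀ T, 0 < T → MemLpBesovSup 3 σ 3 (u j) volume (Ioo 0 T) ∧
      (eLpBesovSupNorm 3 σ 3 (u j) volume (Ioo 0 T)).toReal ^ 3 ≤ A * T + B := by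
    rw [not_eventually] at hnot
    refine hnot.mono fun j hj => ?_
    push Not at hj
    obtain ⟨B, hB⟩ := hj
    exact ⟨B, fun T hT => hB T hT⟩
  obtain ⟨φ, hφ, hφP⟩ := extraction_of_frequently_atTop hfreq
  exact zerothLaw_witness_not_uniformly_besov hf hdiv (fun j => hν (φ j))
    (hν₀.comp hφ.tendsto_atTop) (fun j => hu (φ j)) hε (fun j => hεD (φ j)) hσ A hφP

/-- **The summit implies its Onsager-singular form.** If `AnomalousDissipation` holds then it
holds with a witness whose velocity fields are, for every `σ ∈ (1/3,1]` and every slope `A`,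
eventually (in `j`) outside every linearly-growing ball of `L³(0,T;B^σ_{3,∞})`:
anomalous dissipation with a fixed smooth force forces Onsager-critical roughness of the family in
long-time cubic mean (Drivas–Eyink 2019, Thm. 1, long-time version proved here). [cite: DrivasEyink2019, Thm. 1] -/
theorem anomalousDissipation_imp_onsagerSingularWitness (h : _root_.AnomalousDissipation) :
    ∃ f : 𝕋³ → E³, Torus.IsSmooth f ∧ Torus.IsDivFree f ∧ Torus.HasZeroMean f ∧
      ∃ (ν : ℕ → ℝ) (u₀ : ℕ → 𝕋³ → E³) (u : ℕ → ℝ → 𝕋³ → E³),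
        (∀ j, 0 < ν j) ∧ Tendsto ν atTop (𝓝 0) ∧
        (∀ j, Torus.IsGlobalLerayHopf (ν j) (fun _ => f) (u₀ j) (u j)) ∧
        (∃ E : ℝ, ∀ j, meanEnergy (u j) ≤ E) ∧
        (∃ ε : ℝ, 0 < ε ∧ ∀ j, ε ≤ meanDissipation (ν j) (u j)) ∧
        ∀ σ : ℝ, 1 / 3 < σ → σ ≤ 1 → ∀ A : ℝ, ∀ᶠ j in atTop, ∀ B : ℝ, ∃ T : ℝ, 0 < T ∧
          (MemLpBesovSup 3 σ 3 (u j) volume (Ioo 0 T) →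
            A * T + B < (eLpBesovSupNorm 3 σ 3 (u j) volume (Ioo 0 T)).toReal ^ 3) := by
  obtain ⟨f, hf, hdiv, hmean, ν, u₀, u, hν, hν₀, hu, hE, ε, hε, hεD⟩ := h
  exact ⟨f, hf, hdiv, hmean, ν, u₀, u, hν, hν₀, hu, hE, ⟨ε, hε, hεD⟩,
    fun σ hσ₁ hσ₂ A => zerothLaw_witness_eventually_rough hf hdiv hν hν₀ hu hε hεD ⟨hσ₁, hσ₂⟩ A⟩

end Summit.AnomalousDissipation.AnomalousDissipation.Theorems

end
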